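/- Free lead seat `ym-line-cbag-p1` (prover-ym-line-cbag-p1-g20-0; own crux `BoxFloorAllGroups` stmt-QuantumFields-22254 CLOSED) on the
planner-of-record's LINE 5, route `HankelDensitySplitting`: the node `LatticeNonFreezing` now hinges on the single open crux
`LogWindowMixedDominance` (stmt-QuantumFields-26617).  RECORD-type material; the Yang–Mills mass gap is NOT proved by anything here, and the
node itself is NOT proved here (conditional on the open crux). -/
import Summits.QuantumFields.YangMills.Theorems.HankelDensitySplittingHankelDensityFloor
import Summits.QuantumFields.YangMills.Theorems.HankelDensitySplittingTorusLimitTransfer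
import Summits.QuantumFields.YangMills.Theorems.HankelDensitySplittingAssembly

/-!
# Route `HankelDensitySplitting`: the node `LatticeNonFreezing` from the mixed-dominance crux alone

With the three other items of the route proved in the tree — `hankelDensityFloor_proof` (crux `HankelDensityFloor`, stmt-QuantumFields-26618),
`torusLimitTransfer_proof` (support, 26619), `assembly_proof` (26620) — the route's deciding theorem `closes` leaves exactly one hypothesis:
`LogWindowMixedDominance` (crux stmt-QuantumFields-26617: `g_μ(n−1) − 2 g_μ(n) ≤ t_μ(n)` for `n₁ ≤ n ≤ (log β)²` in every limit state at large
`β` — the growing-window two-sided Gaussian control of the 18 mixed plane-pair covariances, the priced wall of the line).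

`latticeNonFreezing_of_logWindowMixedDominance : LogWindowMixedDominance → LatticeNonFreezing` records this for planners and the tribunal.
NOT the Yang–Mills mass gap; NOT a proof of the node (Chatterjee arXiv:1803.01950 Problem 5.1(b) for the six-plane density stays open in the tree).
-/

noncomputable section

namespace Summit.QuantumFields.YangMills.Theorems.HankelDensitySplitting

/-- **The node `LatticeNonFreezing` follows from the crux `LogWindowMixedDominance` alone** (route `HankelDensitySplitting`): the deciding
theorem `closes` fed with the landed `hankelDensityFloor_proof`, `torusLimitTransfer_proof`, `assembly_proof`.  Conditional statement; the
hypothesis is the open crux stmt-QuantumFields-26617.  NOT the Yang–Mills mass gap. -/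
theorem latticeNonFreezing_of_logWindowMixedDominance
    (h : Summit.QuantumFields.YangMills.Theses.HankelDensitySplitting.LogWindowMixedDominance) :
    Summit.QuantumFields.YangMills.Theorems.LatticeNonFreezing :=
  Summit.QuantumFields.YangMills.Theses.HankelDensitySplitting.closes hankelDensityFloor_proof h torusLimitTransfer_proof
    assembly_proof

end Summit.QuantumFields.YangMills.Theorems.HankelDensitySplitting

end
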